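import Mathlib.MeasureTheory.Integral.MeanInequalities
import Mathlib.MeasureTheory.Measure.Typeclasses.Probability
import Mathlib.Analysis.SpecificLimits.Basic
import HarnessLib

/-!
# Timár 2006, Lemma 4.1: a branching process with bounded interactions survives when `kp > 1`
# — the second-moment core, PROVED

Barrier catalogue `Literature/Barriers/CriticalPhenomena/`; a brick of the programme behind the
named fact `Timar2006_atMostOneCriticalCluster` (`SubexponentialGrowthZdUniqueness.lean`), on
the way to Timár's Thm. 4.3 (no infinite light clusters at `p_c`; vendored in
`TimarCriticalNonunimodular.lean`). Á. Timár, *Percolation on nonunimodular transitive graphs*,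
Ann. Probab. 34 (2006) 2344–2364, proves Thm. 4.3 by growing, inside a Bernoulli(`p̃`)
configuration with `p̃ < p_c`, a random tree `T` whose `m`-th generation `O_m` lives in the
`m`-th slab of levels, and concluding from

> **Lemma 4.1.** Consider a random rooted tree with the following properties. Fix some `p > 0`
> and define `O_0 := {o}`, where `o` is the root. If a generation `O_m` is already given, then
> the number of children that the vertices in `O_m` will have depends only on `O_m` (and not on
> the past). Each vertex of `O_m` has at least `k` children with probability `p` and `0` children
> otherwise. Further, the number of children of a vertex `x ∈ O_m` is independent of the number of
> children of all but at most `σ` of the other vertices in `O_m`. … Then the tree is infinite with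
> positive probability whenever `kp > 1`.

The printed proof reduces to "exactly `k` children with probability `p`", bounds the conditional
second moment of `X := |O_{m+1}|` by `E[X²] ≤ Σ_{i,j} E[X_i]E[X_j] + k²σn` (`n = |O_m|`), and
shows that `Y_m := |O_m|/(pk)^m` has uniformly bounded second moments,
`E[Y_m²] ≤ E[Y_{m-1}²] + k²σ E[Y_{m-1}] (pk)^{-m-1} ≤ k²σ Σ_{i ≤ m+1} (pk)^{-i}`, whence (by
martingale convergence) `Y_m → Y` with `E Y = 1`, `P[Y > 0] > 0`, and non-extinction.

This file PROVES the analytic core in the form the formal proof of Thm. 4.3 will consume: the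
two moment recursions that the printed argument extracts from the branching structure,

  `E Z_{m+1} ≥ κ E Z_m`,  `E Z_{m+1}² ≤ κ² E Z_m² + C E Z_m`  (`κ = kp > 1`, `C = k²σ`),

imply `P[Z_m > 0 for all m] ≥ (1 + C κ⁻² (1 − κ⁻¹)⁻¹)⁻¹ > 0`
(`le_measure_forall_ne_zero_of_moments`, `measure_forall_ne_zero_pos_of_moments`). Instead of
martingale convergence we close with the second-moment (Cauchy–Schwarz / Paley–Zygmund at
level `0`) inequality `(E Z)² ≤ E[Z²] P[Z > 0]` (`lintegral_sq_le_mul_measure_ne_zero`) applied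
to each `Z_m`, using the same uniform bound `E[Z_m²] ≤ R (E Z_m)²` that the printed computation
establishes for `Y_m`, and the monotonicity of the extinction events; this variant of the last
step gives the printed conclusion with an explicit constant. The probabilistic bookkeeping of
Lemma 4.1 (generations, the dependency bound `σ`, thinning "at least `k` children with
probability at least `p`" to "exactly `k` with probability exactly `p`") is what produces the two
recursions and is left to the user of this lemma (the proof of Thm. 4.3), exactly as in the
printed proof's first sentence.

## References

* Á. Timár, Ann. Probab. 34 (2006) 2344–2364 (arXiv:math/0702875), Lemma 4.1 and its proof
  (p. 2352). [Timar2006]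
* R. Lyons, Y. Peres, *Probability on Trees and Networks*, CUP 2016, §5.5 (the Paley–Zygmund
  inequality; second-moment method). [LyonsPeres2016]
-/

noncomputable section

namespace Literature.Barriers.CriticalPhenomena

open _root_.MeasureTheory
open scoped ENNReal

variable {Ω : Type*} [MeasurableSpace Ω]

/-! ### The second-moment inequality `(E Z)² ≤ E[Z²] · P[Z ≠ 0]` -/

/-- The event `{Z ≠ 0}` of a measurable `[0, ∞]`-valued function is measurable. [folklore] -/
theorem measurableSet_ne_zero {Z : Ω → ℝ≥0∞} (hZ : Measurable Z) :
    MeasurableSet {ω | Z ω ≠ 0} :=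
  hZ (measurableSet_singleton 0).compl

/-- **Second-moment inequality (Paley–Zygmund at level `0`)**: for a measurable
`Z : Ω → [0, ∞]`, `(∫ Z)² ≤ (∫ Z²) · μ{Z ≠ 0}` — Cauchy–Schwarz for `Z = Z · 1_{Z ≠ 0}`
(Lyons–Peres 2016, §5.5; the step "`E[X]² = E[X 1_{X>0}]² ≤ E[X²] P[X > 0]`").
[cite: LyonsPeres2016, §5.5 (Paley–Zygmund inequality)] -/
theorem lintegral_sq_le_mul_measure_ne_zero (μ : Measure Ω) {Z : Ω → ℝ≥0∞} (hZ : Measurable Z) :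
    (∫⁻ ω, Z ω ∂μ) ^ 2 ≤ (∫⁻ ω, Z ω ^ 2 ∂μ) * μ {ω | Z ω ≠ 0} := by
  set S : Set Ω := {ω | Z ω ≠ 0} with hS_def
  have hS : MeasurableSet S := measurableSet_ne_zero hZ
  set g : Ω → ℝ≥0∞ := S.indicator 1 with hg_def
  have hg : Measurable g := measurable_one.indicator hS
  -- `Z = Z · 1_S`
  have hZg : ∀ ω, Z ω = (Z * g) ω := by
    intro ω
    simp only [Pi.mul_apply, hg_def]
    by_cases hω : ω ∈ S
    · rw [Set.indicator_of_mem hω, Pi.one_apply, mul_one]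
    · have h0 : Z ω = 0 := by
        by_contra h
        exact hω h
      rw [h0, zero_mul]
  -- `1_S ^ 2 = 1_S` and `∫ 1_S = μ S`
  have hg2 : ∀ ω, g ω ^ 2 = g ω := by
    intro ω
    simp only [hg_def]
    by_cases hω : ω ∈ S
    · rw [Set.indicator_of_mem hω, Pi.one_apply, one_pow]
    · rw [Set.indicator_of_notMem hω, zero_pow two_ne_zero]
  have h := ENNReal.lintegral_mul_le_Lp_mul_Lq μ Real.HolderConjugate.two_two hZ.aemeasurable
    hg.aemeasurable
  simp only [ENNReal.rpow_two] at h
  have hgint : ∫⁻ ω, g ω ∂μ = μ S := by rw [hg_def, lintegral_indicator_one hS]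
  rw [lintegral_congr hg2, hgint] at h
  calc (∫⁻ ω, Z ω ∂μ) ^ 2 = (∫⁻ ω, (Z * g) ω ∂μ) ^ 2 := by
        rw [lintegral_congr hZg]
    _ ≤ ((∫⁻ ω, Z ω ^ 2 ∂μ) ^ (1 / 2 : ℝ) * μ S ^ (1 / 2 : ℝ)) ^ 2 := by
        gcongr
    _ = (∫⁻ ω, Z ω ^ 2 ∂μ) * μ S := by
        rw [← ENNReal.mul_rpow_of_nonneg _ _ (by norm_num : (0 : ℝ) ≤ 1 / 2), ← ENNReal.rpow_two,
          ← ENNReal.rpow_mul]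
        norm_num

/-- Hence `P[Z ≠ 0] ≥ (E Z)² / E[Z²]` in the cancellation-free form
`(E Z)² ≤ R (E Z)² P[Z ≠ 0]` whenever `E[Z²] ≤ R (E Z)²`. [folklore] -/
theorem lintegral_sq_le_of_sq_moment_le (μ : Measure Ω) {Z : Ω → ℝ≥0∞} (hZ : Measurable Z)
    {R : ℝ≥0∞} (hR : ∫⁻ ω, Z ω ^ 2 ∂μ ≤ R * (∫⁻ ω, Z ω ∂μ) ^ 2) :
    (∫⁻ ω, Z ω ∂μ) ^ 2 ≤ R * (∫⁻ ω, Z ω ∂μ) ^ 2 * μ {ω | Z ω ≠ 0} :=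
  (lintegral_sq_le_mul_measure_ne_zero μ hZ).trans (by gcongr)

/-- An extended nonnegative real is at most its square plus one. [folklore] -/
theorem ENNReal.le_sq_add_one (z : ℝ≥0∞) : z ≤ z ^ 2 + 1 := by
  rcases le_total z 1 with h | h
  · exact h.trans le_add_self
  · calc z = z * 1 := (mul_one z).symm
      _ ≤ z * z := by gcongr
      _ = z ^ 2 := (sq z).symm
      _ ≤ z ^ 2 + 1 := le_self_add

/-! ### Timár's Lemma 4.1: survival from the two moment recursions -/

/-- **Timár 2006, Lemma 4.1 (second-moment core), PROVED, quantitative form.** Let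
`Z_0, Z_1, … : Ω → [0, ∞]` be measurable on a probability space (`Z_m = |O_m|`, the generation
sizes), with `Z_0 = 1`, extinction persistent (`Z_{m+1} ≠ 0 → Z_m ≠ 0`), and satisfying the two
moment recursions of the printed proof with `κ = kp ∈ (1, ∞)` and `C = k²σ < ∞`:
`κ E Z_m ≤ E Z_{m+1}` and `E Z_{m+1}² ≤ κ² E Z_m² + C E Z_m`. Then
`P[Z_m ≠ 0 for all m] ≥ (1 + C κ⁻² (1 − κ⁻¹)⁻¹)⁻¹` ("Then the tree is infinite with positive
probability whenever `kp > 1`"). Proof: by induction `E Z_m ≥ κ^m` and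
`E[Z_m²] ≤ R_m (E Z_m)²` with `R_m = 1 + C Σ_{i<m} κ^{-(i+2)} ≤ R := 1 + C κ⁻² (1 − κ⁻¹)⁻¹` (the
printed bound on `E[Y_m²]`), then `(E Z_m)² ≤ E[Z_m²] P[Z_m ≠ 0]`
(`lintegral_sq_le_mul_measure_ne_zero`) gives `P[Z_m ≠ 0] ≥ R⁻¹` for every `m`, and the events
`{Z_m ≠ 0}` decrease to `{∀ m, Z_m ≠ 0}`.
[cite: Timar2006, Lemma 4.1 (proof: E[Y_m²] ≤ E[Y_{m-1}²] + k²σ E[Y_{m-1}] (pk)^{-m-1})] -/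
theorem le_measure_forall_ne_zero_of_moments (μ : Measure Ω) [IsProbabilityMeasure μ]
    (Z : ℕ → Ω → ℝ≥0∞) (hZ : ∀ m, Measurable (Z m)) {κ C : ℝ≥0∞} (hκ : 1 < κ) (hκT : κ ≠ ⊤)
    (hC : C ≠ ⊤) (h0 : ∀ ω, Z 0 ω = 1)
    (hmean : ∀ m, κ * ∫⁻ ω, Z m ω ∂μ ≤ ∫⁻ ω, Z (m + 1) ω ∂μ)
    (hsq : ∀ m, ∫⁻ ω, Z (m + 1) ω ^ 2 ∂μ ≤ κ ^ 2 * ∫⁻ ω, Z m ω ^ 2 ∂μ + C * ∫⁻ ω, Z m ω ∂μ)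
    (hmono : ∀ m ω, Z (m + 1) ω ≠ 0 → Z m ω ≠ 0) :
    (1 + C * (κ ^ 2)⁻¹ * (1 - κ⁻¹)⁻¹)⁻¹ ≤ μ {ω | ∀ m, Z m ω ≠ 0} := by
  -- notation: first and second moments
  set a : ℕ → ℝ≥0∞ := fun m => ∫⁻ ω, Z m ω ∂μ with ha_def
  set b : ℕ → ℝ≥0∞ := fun m => ∫⁻ ω, Z m ω ^ 2 ∂μ with hb_def
  have hκ0 : κ ≠ 0 := (zero_lt_one.trans hκ).ne'
  have hκpow0 : ∀ n : ℕ, κ ^ n ≠ 0 := fun n => pow_ne_zero n hκ0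
  have hκpowT : ∀ n : ℕ, κ ^ n ≠ ⊤ := fun n => ENNReal.pow_ne_top hκT
  -- `a 0 = 1`, `b 0 = 1`
  have ha0 : a 0 = 1 := by
    simp only [ha_def, h0, lintegral_const, measure_univ, mul_one]
  have hb0 : b 0 = 1 := by
    simp only [hb_def, h0, one_pow, lintegral_const, measure_univ, mul_one]
  -- first moments grow at least like `κ^m`
  have ha_ge : ∀ m, κ ^ m ≤ a m := by
    intro m
    induction m with
    | zero => rw [pow_zero, ha0]
    | succ m ih =>
      calc κ ^ (m + 1) = κ * κ ^ m := by ring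
        _ ≤ κ * a m := by gcongr
        _ ≤ a (m + 1) := hmean m
  have ha_ne0 : ∀ m, a m ≠ 0 := fun m => (lt_of_lt_of_le (pos_iff_ne_zero.2 (hκpow0 m)) (ha_ge m)).ne'
  -- second moments are finite, hence so are first moments (`Z ≤ Z² + 1`)
  have ha_le_b : ∀ m, a m ≤ b m + 1 := by
    intro m
    calc a m ≤ ∫⁻ ω, (Z m ω ^ 2 + 1) ∂μ := lintegral_mono fun ω => ENNReal.le_sq_add_one _
      _ = b m + 1 := by
          rw [lintegral_add_right _ measurable_const, lintegral_const, measure_univ, mul_one]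
  have hb_neT : ∀ m, b m ≠ ⊤ := by
    intro m
    induction m with
    | zero => rw [hb0]; exact ENNReal.one_ne_top
    | succ m ih =>
      have haT : a m ≠ ⊤ := ne_top_of_le_ne_top (by simpa using ih) (ha_le_b m)
      exact ne_top_of_le_ne_top (by
        refine ENNReal.add_ne_top.2 ⟨ENNReal.mul_ne_top (hκpowT 2) ih, ENNReal.mul_ne_top hC haT⟩)
        (hsq m)
  have ha_neT : ∀ m, a m ≠ ⊤ := fun m =>
    ne_top_of_le_ne_top (by simpa using hb_neT m) (ha_le_b m)
  -- the ratio bound `b m ≤ R m * (a m)^2`, `R m = 1 + C Σ_{i<m} (κ^(i+2))⁻¹`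
  set D : ℕ → ℝ≥0∞ := fun i => C * (κ ^ (i + 2))⁻¹ with hD_def
  set R : ℕ → ℝ≥0∞ := fun m => 1 + ∑ i ∈ Finset.range m, D i with hR_def
  have hratio : ∀ m, b m ≤ R m * a m ^ 2 := by
    intro m
    induction m with
    | zero => simp [hR_def, hb0, ha0]
    | succ m ih =>
      -- `C a_m ≤ D_m κ² a_m²` because `a_m ≥ κ^m`
      have hstep : C * a m ≤ D m * (κ ^ 2 * a m ^ 2) := by
        have h1 : D m * κ ^ (m + 2) = C := by
          rw [hD_def]
          show C * (κ ^ (m + 2))⁻¹ * κ ^ (m + 2) = C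
          rw [mul_assoc, ENNReal.inv_mul_cancel (hκpow0 _) (hκpowT _), mul_one]
        calc C * a m = D m * κ ^ (m + 2) * a m := by rw [h1]
          _ = D m * (κ ^ 2 * (κ ^ m * a m)) := by ring
          _ ≤ D m * (κ ^ 2 * (a m * a m)) := by gcongr; exact ha_ge m
          _ = D m * (κ ^ 2 * a m ^ 2) := by ring
      calc b (m + 1) ≤ κ ^ 2 * b m + C * a m := hsq m
        _ ≤ κ ^ 2 * (R m * a m ^ 2) + D m * (κ ^ 2 * a m ^ 2) := add_le_add (by gcongr) hstep
        _ = (R m + D m) * (κ ^ 2 * a m ^ 2) := by ring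
        _ = R (m + 1) * (κ * a m) ^ 2 := by
            rw [hR_def]
            simp only [Finset.sum_range_succ]
            ring
        _ ≤ R (m + 1) * a (m + 1) ^ 2 := by gcongr; exact hmean m
  -- `R m ≤ R∞ := 1 + C κ⁻² (1 - κ⁻¹)⁻¹`
  set Rinf : ℝ≥0∞ := 1 + C * (κ ^ 2)⁻¹ * (1 - κ⁻¹)⁻¹ with hRinf_def
  have hR_le : ∀ m, R m ≤ Rinf := by
    intro m
    have hgeom : ∑' i : ℕ, (κ⁻¹) ^ i = (1 - κ⁻¹)⁻¹ := ENNReal.tsum_geometric _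
    have hsum : ∑ i ∈ Finset.range m, D i ≤ C * (κ ^ 2)⁻¹ * (1 - κ⁻¹)⁻¹ := by
      calc ∑ i ∈ Finset.range m, D i = ∑ i ∈ Finset.range m, C * (κ ^ 2)⁻¹ * (κ⁻¹) ^ i := by
            refine Finset.sum_congr rfl fun i _ => ?_
            rw [hD_def]
            show C * (κ ^ (i + 2))⁻¹ = C * (κ ^ 2)⁻¹ * κ⁻¹ ^ i
            rw [pow_add, ENNReal.mul_inv (Or.inl (hκpow0 i)) (Or.inl (hκpowT i)),
              ENNReal.inv_pow, mul_comm ((κ⁻¹) ^ i), mul_assoc]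
        _ = C * (κ ^ 2)⁻¹ * ∑ i ∈ Finset.range m, (κ⁻¹) ^ i := by rw [Finset.mul_sum]
        _ ≤ C * (κ ^ 2)⁻¹ * ∑' i : ℕ, (κ⁻¹) ^ i := by
            gcongr; exact ENNReal.sum_le_tsum _
        _ = C * (κ ^ 2)⁻¹ * (1 - κ⁻¹)⁻¹ := by rw [hgeom]
    calc R m = 1 + ∑ i ∈ Finset.range m, D i := rfl
      _ ≤ 1 + C * (κ ^ 2)⁻¹ * (1 - κ⁻¹)⁻¹ := by gcongr
      _ = Rinf := rfl
  have hRinf0 : Rinf ≠ 0 := by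
    rw [hRinf_def]; exact ne_of_gt (lt_of_lt_of_le zero_lt_one le_self_add)
  -- each extinction event has probability at least `Rinf⁻¹`
  have hS : ∀ m, MeasurableSet {ω | Z m ω ≠ 0} := fun m => measurableSet_ne_zero (hZ m)
  have hPm : ∀ m, Rinf⁻¹ ≤ μ {ω | Z m ω ≠ 0} := by
    intro m
    have h1 : a m ^ 2 ≤ Rinf * a m ^ 2 * μ {ω | Z m ω ≠ 0} :=
      lintegral_sq_le_of_sq_moment_le μ (hZ m)
        ((hratio m).trans (by gcongr; exact hR_le m))
    have ha2_0 : a m ^ 2 ≠ 0 := pow_ne_zero 2 (ha_ne0 m)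
    have ha2_T : a m ^ 2 ≠ ⊤ := ENNReal.pow_ne_top (ha_neT m)
    -- cancel `a m ^ 2`
    have h2 : 1 ≤ Rinf * μ {ω | Z m ω ≠ 0} := by
      rw [mul_comm Rinf, mul_assoc] at h1
      calc (1 : ℝ≥0∞) = a m ^ 2 * (a m ^ 2)⁻¹ := (ENNReal.mul_inv_cancel ha2_0 ha2_T).symm
        _ ≤ a m ^ 2 * (Rinf * μ {ω | Z m ω ≠ 0}) * (a m ^ 2)⁻¹ := by gcongr
        _ = Rinf * μ {ω | Z m ω ≠ 0} := by
            rw [mul_comm (a m ^ 2), mul_assoc, ENNReal.mul_inv_cancel ha2_0 ha2_T, mul_one]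
    by_cases hRT : Rinf = ⊤
    · rw [hRT, ENNReal.inv_top]; exact zero_le
    calc Rinf⁻¹ = Rinf⁻¹ * 1 := (mul_one _).symm
      _ ≤ Rinf⁻¹ * (Rinf * μ {ω | Z m ω ≠ 0}) := by gcongr
      _ = μ {ω | Z m ω ≠ 0} := by rw [← mul_assoc, ENNReal.inv_mul_cancel hRinf0 hRT, one_mul]
  -- the events decrease to `{∀ m, Z m ≠ 0}`
  have hanti : Antitone fun m => {ω | Z m ω ≠ 0} := by
    refine antitone_nat_of_succ_le fun m => ?_
    exact fun ω hω => hmono m ω hω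
  have hInter : {ω | ∀ m, Z m ω ≠ 0} = ⋂ m, {ω | Z m ω ≠ 0} := Set.setOf_forall _
  rw [hInter, hanti.measure_iInter (fun m => (hS m).nullMeasurableSet) ⟨0, measure_ne_top μ _⟩]
  exact le_iInf hPm

/-- **Timár 2006, Lemma 4.1 (second-moment core), PROVED** — "Then the tree is infinite with
positive probability whenever `kp > 1`": under the two moment recursions with `κ = kp > 1`
finite and `C < ∞`, `P[Z_m ≠ 0 for all m] > 0`.
[cite: Timar2006, Lemma 4.1] -/
theorem measure_forall_ne_zero_pos_of_moments (μ : Measure Ω) [IsProbabilityMeasure μ]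
    (Z : ℕ → Ω → ℝ≥0∞) (hZ : ∀ m, Measurable (Z m)) {κ C : ℝ≥0∞} (hκ : 1 < κ) (hκT : κ ≠ ⊤)
    (hC : C ≠ ⊤) (h0 : ∀ ω, Z 0 ω = 1)
    (hmean : ∀ m, κ * ∫⁻ ω, Z m ω ∂μ ≤ ∫⁻ ω, Z (m + 1) ω ∂μ)
    (hsq : ∀ m, ∫⁻ ω, Z (m + 1) ω ^ 2 ∂μ ≤ κ ^ 2 * ∫⁻ ω, Z m ω ^ 2 ∂μ + C * ∫⁻ ω, Z m ω ∂μ)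
    (hmono : ∀ m ω, Z (m + 1) ω ≠ 0 → Z m ω ≠ 0) :
    0 < μ {ω | ∀ m, Z m ω ≠ 0} := by
  refine lt_of_lt_of_le ?_ (le_measure_forall_ne_zero_of_moments μ Z hZ hκ hκT hC h0 hmean hsq hmono)
  rw [ENNReal.inv_pos]
  -- `1 + C κ⁻² (1 - κ⁻¹)⁻¹ < ∞` since `κ⁻¹ < 1`
  have hκ0 : κ ≠ 0 := (zero_lt_one.trans hκ).ne'
  have hlt : κ⁻¹ < 1 := by rw [ENNReal.inv_lt_one]; exact hκ
  refine ENNReal.add_ne_top.2 ⟨ENNReal.one_ne_top, ENNReal.mul_ne_top (ENNReal.mul_ne_top hC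
    (ENNReal.inv_ne_top.2 (pow_ne_zero 2 hκ0))) (ENNReal.inv_ne_top.2 ?_)⟩
  exact (tsub_pos_of_lt hlt).ne'

end Literature.Barriers.CriticalPhenomena

end
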